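import Mathlib

/-!
# Tier4/Line3/MixedDensity — a number field is dense in its mixed space (weak approximation at the archimedean places)

Blind re-derivation cell `pub-hodge-repro`, Tier 4 «PROVE THE STEP», LINE L3, seat t4-L3-p2 (g3): piece (1) of C-L3-GENREACH
(STATUS S14746 / S14748). Pure Mathlib: the image of a number field `K` under `NumberField.mixedEmbedding` meets every
non-empty open subset of the mixed space `ℝ^{r₁} × ℂ^{r₂}` — the ℚ-span of the ℝ-basis `mixedEmbedding.latticeBasis` (the
image of an integral basis) is dense, because every real coordinate is approximated by a rational (`exists_rat_near`).
Consequence for a totally complex field (every infinite place complex): for positive targets `c w` at the complex places and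
any ratio `ρ > 1` there is `x ≠ 0` in `K` with `c w / ρ < (w x)² < c w · ρ` at every place — the sizes of `x` at all the
places can be prescribed up to any ratio simultaneously (`exists_ne_zero_sq_place_mem_Ioo`).

Nothing here says anything about the status of the Hodge conjecture for CM abelian varieties, which is NOT proved
(HC_CM is NOT proved by anyone in this repository).
-/

set_option autoImplicit false

noncomputable section

namespace Summit.Ventures.HodgeRepro.Tier4.Line3

open NumberField NumberField.InfinitePlace NumberField.mixedEmbedding
open scoped Classical

variable (K : Type) [Field K] [NumberField K]

omit [NumberField K] in
/-- The image of a rational multiple is the real scalar multiple of the image. -/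
theorem mixedEmbedding_ratCast_mul (q : ℚ) (v : K) :
    mixedEmbedding K ((q : K) * v) = (q : ℝ) • mixedEmbedding K v := by
  rw [map_mul]
  ext w
  · simp [mixedEmbedding_apply_isReal]
  · simp [mixedEmbedding_apply_isComplex, Complex.real_smul]

/-- The image of a rational combination of the integral basis is the same real combination of the lattice basis. -/
theorem mixedEmbedding_sum_ratCast_mul (q : Module.Free.ChooseBasisIndex ℤ (𝓞 K) → ℚ) :
    mixedEmbedding K (∑ i, (q i : K) * integralBasis K i) = ∑ i, (q i : ℝ) • latticeBasis K i := by
  rw [map_sum]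
  refine Finset.sum_congr rfl fun i _ => ?_
  rw [mixedEmbedding_ratCast_mul, latticeBasis_apply]

/-- **THE NUMBER FIELD IS DENSE IN ITS MIXED SPACE**: the image of `K` meets every non-empty open set. -/
theorem exists_mixedEmbedding_mem_of_isOpen {U : Set (mixedSpace K)} (hU : IsOpen U) (hne : U.Nonempty) :
    ∃ x : K, mixedEmbedding K x ∈ U := by
  obtain ⟨v, hv⟩ := hne
  obtain ⟨ε, hε, hball⟩ := Metric.isOpen_iff.1 hU v hv
  set b := latticeBasis K with hb
  set M : ℝ := ∑ i, ‖b i‖ with hM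
  have hM0 : 0 ≤ M := Finset.sum_nonneg fun i _ => norm_nonneg _
  have hδ : 0 < ε / (M + 1) := by positivity
  -- rational approximations of the coordinates of `v`
  have hq : ∀ i, ∃ q : ℚ, |b.repr v i - q| < ε / (M + 1) := fun i => exists_rat_near _ hδ
  choose q hq using hq
  refine ⟨∑ i, (q i : K) * integralBasis K i, hball ?_⟩
  rw [Metric.mem_ball, dist_eq_norm, mixedEmbedding_sum_ratCast_mul]
  have hv' : v = ∑ i, b.repr v i • b i := (b.sum_repr v).symm
  have hrepr : ∑ i, (q i : ℝ) • b i - v = ∑ i, ((q i : ℝ) - b.repr v i) • b i := by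
    conv_lhs => rw [hv']
    rw [← Finset.sum_sub_distrib]
    exact Finset.sum_congr rfl fun i _ => (sub_smul _ _ _).symm
  rw [hrepr]
  calc ‖∑ i, ((q i : ℝ) - b.repr v i) • b i‖ ≤ ∑ i, ‖((q i : ℝ) - b.repr v i) • b i‖ := norm_sum_le _ _
    _ = ∑ i, |(q i : ℝ) - b.repr v i| * ‖b i‖ := by
        refine Finset.sum_congr rfl fun i _ => ?_
        rw [_root_.norm_smul, Real.norm_eq_abs]
    _ ≤ ∑ i, (ε / (M + 1)) * ‖b i‖ := by
        refine Finset.sum_le_sum fun i _ => ?_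
        refine mul_le_mul_of_nonneg_right ?_ (norm_nonneg _)
        rw [abs_sub_comm]
        exact (hq i).le
    _ = ε / (M + 1) * M := by rw [← Finset.mul_sum]
    _ < ε := by
        rw [div_mul_eq_mul_div, div_lt_iff₀ (by positivity)]
        nlinarith

/-- **PRESCRIBED SIZES AT THE COMPLEX PLACES** of a totally complex number field: for positive targets `c w` and a ratio
`ρ > 1` there is `x ≠ 0` with `c w / ρ < (w x)² < c w · ρ` at every complex place `w`. -/
theorem exists_ne_zero_sq_place_mem_Ioo [IsTotallyComplex K] (c : {w : InfinitePlace K // IsComplex w} → ℝ)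
    (hc : ∀ w, 0 < c w) {ρ : ℝ} (hρ : 1 < ρ) :
    ∃ x : K, x ≠ 0 ∧ ∀ w : {w : InfinitePlace K // IsComplex w},
      c w / ρ < (w.1 x) ^ 2 ∧ (w.1 x) ^ 2 < c w * ρ := by
  have hρ0 : 0 < ρ := by linarith
  -- the open set of points of the mixed space whose complex coordinates have the prescribed sizes
  let U : Set (mixedSpace K) := {y | ∀ w : {w : InfinitePlace K // IsComplex w},
    c w / ρ < ‖y.2 w‖ ^ 2 ∧ ‖y.2 w‖ ^ 2 < c w * ρ}
  have hU : IsOpen U := by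
    have : U = ⋂ w : {w : InfinitePlace K // IsComplex w},
        ((fun y : mixedSpace K => ‖y.2 w‖ ^ 2) ⁻¹' Set.Ioo (c w / ρ) (c w * ρ)) := by
      ext y
      simp only [U, Set.mem_setOf_eq, Set.mem_iInter, Set.mem_preimage, Set.mem_Ioo]
    rw [this]
    refine isOpen_iInter_of_finite fun w => isOpen_Ioo.preimage ?_
    exact ((continuous_apply w).comp continuous_snd).norm.pow 2
  have hne : U.Nonempty := by
    refine ⟨(0, fun w => ((Real.sqrt (c w) : ℝ) : ℂ)), fun w => ?_⟩
    have h1 : ‖((Real.sqrt (c w) : ℝ) : ℂ)‖ ^ 2 = c w := by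
      rw [Complex.norm_real, Real.norm_eq_abs, abs_of_nonneg (Real.sqrt_nonneg _), Real.sq_sqrt (hc w).le]
    simp only [h1]
    constructor
    · rw [div_lt_iff₀ hρ0]
      nlinarith [hc w]
    · nlinarith [hc w]
  obtain ⟨x, hx⟩ := exists_mixedEmbedding_mem_of_isOpen K hU hne
  have hsize : ∀ w : {w : InfinitePlace K // IsComplex w},
      c w / ρ < (w.1 x) ^ 2 ∧ (w.1 x) ^ 2 < c w * ρ := by
    intro w
    have h := hx w
    rwa [mixedEmbedding_apply_isComplex, norm_embedding_eq] at h
  refine ⟨x, ?_, hsize⟩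
  intro h0
  obtain ⟨w⟩ := (inferInstance : Nonempty (InfinitePlace K))
  have hw : IsComplex w := IsTotallyComplex.isComplex w
  have := (hsize ⟨w, hw⟩).1
  rw [h0, map_zero, zero_pow (by norm_num : (2 : ℕ) ≠ 0)] at this
  have hcw := hc ⟨w, hw⟩
  linarith [div_pos hcw hρ0]

end Summit.Ventures.HodgeRepro.Tier4.Line3

end
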